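/-
Origin: expansion seat `planner-pub-hodgecm-mc-unitary-1-g3-0`, handover #1 2026-08-19T00:52Z md5 a349bff8c1c8844ed31e4a85e39623f3 SUPERSEDES cb8b8745876e (rev-b) and 1099b3bf6d3a (rev-a) (NEW additive leaf, 328 l., node E binder wm = VACANCY (v19-a) STEP 2 v0 rev-c = rev-b + LINEARITY: `WmInput` gains 3 Prop fields SK_zero/SK_add/SK_smul (𝒮^κ a linear subspace), rfl lemmas wmOf_W_theta / wmOf'_W_theta, aux rep_act_add/_smul, rep_theta_add/_smul (map_add/map_smul), `@[ (`HOME/mc/pub-hodgecm-mc-unitary-1-g3/work/pkg/HodgeCM/Model/WmInstance.lean`, md5 a349bff8, 328 lines);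
landed by the gen-9 packager (p-g9) in gate run 33 as `HodgeCM/Model/WmInstance.lean` (verbatim).
-/
/-
Origin: construction seat `planner-pub-hodgecm-mc-unitary-1-g3-0` (unit pub-hodgecm-mc-unitary-1-g3, CONSTRUCTION PROVER
gen 3 — unitary/adelic plumbing lane), MODEL-DAG node E binder `wm`, VACANCY (v19-a) (ruling (U′) model2-g4
2026-08-18T23:34Z), STEP 2 **v0**.  NEW additive package leaf `HodgeCM/Model/WmInstance.lean` (RUN 33, CUT #2).
Inventory of sources: `HOME/mc/pub-hodgecm-mc-unitary-1-g3/notes/WM-SOURCES.md`.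
-/
import Summits.HodgeConjecture.HodgeCM.Model.Junction.WeilThetaModelComap
import Summits.HodgeConjecture.HodgeCM.Automorphic.WeilThetaModelLinear_2
import Summits.HodgeConjecture.HodgeCM.Model.Junction.ThetaKernelDatumToPkg
import Literature.NumberTheory.Weil1964.ThetaDualPairDatum

/-!
# Node E, binder `wm`: the Weil theta model of a context, PRODUCED (v0)

The END STATE field (`Universe.AdelicThetaCore.wm`, `HodgeCM/Model/E2InstanceR4.lean` l.52–56)

  `wm : ∀ {L} {ι₁} (V : HermSpace3 L ι₁) (c : SeesawCtx L),
     WeilThetaModel (V.latticeModel hP).toQuotientModel.G (V.latticeModel hP).toQuotientModel.Γ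
                    (c.D.latticeModelW hP).toQuotientModel.G (c.D.latticeModelW hP).toQuotientModel.Γ`

asks for Weil's theta model (Weil 1964 n° 39 + Thm 6 BY NAME, a continuous splitting of the dual pair, a stable
index space) over the MODEL groups of the two lattice models, i.e. (all `rfl`) over
`↥(regimeSubgroup L V.Hm) ≥ regimeRat L V.Hm` and `↥(regimeSubgroup L diag(a₀,a₁)) ≥ regimeRat L diag(a₀,a₁)`.

**This file (v0) is PLUMBING ONLY — kernel conversions, no cited fact, no hypothesis of type `Prop` minted here.**
It produces that field from the following NAMED inputs (= the OPEN / not-yet-vendored rows of `WM-SOURCES.md`),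
for ANY pair of locally compact groups `GU ⊇ ΓU`, `G ⊇ Γ` standing in for `U(J_V)(𝔸_{L⁺})`, `U(J_W)(𝔸_{L⁺})`
and their rational points:

* `ρ : GU × G →* (Module.End ℂ 𝒮(𝔸_F^ι))ˣ` — the linearised adelic Weil representation of the pair
  (v1: `ρ := ω_ψ ∘ s_pair`, weil-2's `adelicMpCont.omega` p179969 composed with the Gelbart–Rogawski pair splitting
  extracted from the record `GelbartRogawski1991.SplittingDatum.CompatibleSplitting` p179542 — rows I-2/I-5, OPEN (P1));
* `hρ : HasThetaMajorants ρ` — Weil n° 41 Lemme 5 in M-test form, locally uniformly on `GU × G` (row I-8 (ii),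
  OPEN (W-1) = proposed sub-vacancy (v19-b), W lanes);
* `hrat : ρ(ΓU × Γ) ⊆ Stab(Θ)` — Θ-rationality of the rational points (row I-7, derivable from the GR91 record through
  `CompatibleSplitting.exists_hom_forall_map_mem` + weil-2's `thetaDist_omega_ratThetaLiftCont` p180084, inside (P1));
* `eV : U(V.Hm)(𝔸) →* GU`, `eW : U(diag(a₀,a₁))(𝔸) →* G` continuous, carrying rational points into `ΓU`, `Γ`
  (row I-11: frame transports `unitaryGroupOfFormCongr` p177989 + `adelic_complexConj`; for `V.Hm` this needs the
  rational orthogonal frame (P2)).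

From these, EVERYTHING ELSE is already landed: theta-2's split adelic datum
`ThetaKernelDatum.adelicOfDualPair ρ hρ hrat SK SK_stable` (`Weil1964/ThetaDualPairDatum`, p177880 — Weil datum
`repWeilThetaDatum` with the theta-initial topology, so n° 39 and `dist_cont` hold BY CONSTRUCTION and Thm 6 is
`thetaContinuousInvariant_repWeilThetaDatum ρ rat hρ hrat`), glue-1's junction J3 `ThetaKernelDatum.toPkg`
(`Model/Junction/ThetaKernelDatumToPkg`), glue-1-g2's junction J1 `WeilThetaModel.comap` / `toLatticeModels`
(`Model/Junction/WeilThetaModelComap`).  The index space `SK ⊆ 𝒮(𝔸_F^ι)` and its `U(W)`-stability are PARAMETERS (binder-1-g3 23:55Z: the `real34` binder needs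
`SK = 𝒮^κ`, the `κ = ∧²𝔭₊ ⊠ 𝟏`-isotypic subspace of PerL l. 341, not all of `𝒮`).

## Contents
* `Model.wmAdelic`  : the model over the adelic unitary groups `U(V.Hm)(𝔸) ⊇ U(V.Hm)(L⁺)`, `U(diag(a₀,a₁))(𝔸) ⊇ …`;
* `Model.wmOf`      : **the END-STATE field shape** (exactly the type of the binder `wm V c`, with `S := c.D`);
* bookkeeping (`rfl`-grade): `wmAdelic_W_act`, `wmAdelic_s_apply`, `wmAdelic_thetaFun_mk`, `wmOf_eq`, `wmOf_W_act`,
  `wmOf_thetaFun_mk`, `wmOf_θ_mk` — the theta kernel of the produced model on representatives is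
  `θ_Φ(xΓU, yΓ) = Θ(ρ(eV x⁻¹, eW y⁻¹) Φ)` (Weil's adelic theta kernel of the pair), which is what the
  `Theta` / `classPacks` / `occ` producers (theta-3 `SupplyResidual`, binder-2) consume.

E consumes it as `wm := fun V c => Model.wmOf hP V c.D (ρ V c) (hρ V c) (hrat V c) (SK V c) (SK_stable V c) (eV V c) … (hΓW V c)`:
the DATA binder `wm` is replaced by the inputs above; of these only `hρ` (K-open, (W-1)) and the GR91 print record
behind `ρ`/`hrat` (P, MODEL-N row N-d2, already booked) are not kernel today.
-/

noncomputable section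

open scoped Topology

namespace HodgeCM.Model

open HodgeCM.Adelic Literature.NumberTheory.Weil1964 Literature.NumberTheory.Automorphic NumberField

variable {L : CMField} {ι₁ : L →+* ℂ}
variable {F : Type} [Field F] [NumberField F] {ι : Type} [Fintype ι]
variable {GU : Type} [Group GU] [TopologicalSpace GU] [IsTopologicalGroup GU] [LocallyCompactSpace GU]
  {ΓU : Subgroup GU}
variable {G : Type} [Group G] [TopologicalSpace G] [IsTopologicalGroup G] [LocallyCompactSpace G]
  {Γ : Subgroup G}

section

variable (hP : PrintFact_unitaryCompact) (V : HermSpace3 L ι₁) (S : StubTree.SeesawDatum L)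
  (ρ : GU × G →* (Module.End ℂ (piSchwartzBruhat F ι))ˣ)
  (hρ : HasThetaMajorants fun g Φ => (ρ g : Module.End ℂ (piSchwartzBruhat F ι)) Φ)
  (hrat : ∀ γU ∈ ΓU, ∀ γ ∈ Γ, ρ (γU, γ) ∈ thetaStabilizer F ι)
  (SK : Set (piSchwartzBruhat F ι))
  (SK_stable : ∀ (h : G) (Φ : piSchwartzBruhat F ι), Φ ∈ SK →
    (ρ (1, h) : Module.End ℂ (piSchwartzBruhat F ι)) Φ ∈ SK)
  (eV : adelicUnitaryGroup L V.Hm →* GU) (heV : Continuous eV)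
  (hΓV : ∀ γ ∈ adelicUnitaryRat L V.Hm, eV γ ∈ ΓU)
  (eW : adelicUnitaryGroup L (Matrix.diagonal ![S.a 0, S.a 1]) →* G) (heW : Continuous eW)
  (hΓW : ∀ γ ∈ adelicUnitaryRat L (Matrix.diagonal ![S.a 0, S.a 1]), eW γ ∈ Γ)

/-- **The Weil theta model of the pair over the adelic unitary groups** `U(V.Hm)(𝔸_{L⁺})`, `U(diag(a₀,a₁))(𝔸_{L⁺})`
(with their rational points as lattices), produced from a majorised, Θ-rational linearised Weil representation `ρ`
of a pair of locally compact groups receiving them: theta-2's split adelic theta-kernel datum, moved to the package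
currency by J3 and pulled back along `(eV, eW)` by J1.  Index space `SK` (a parameter). -/
def wmAdelic :
    WeilThetaModel (adelicUnitaryGroup L V.Hm) (adelicUnitaryRat L V.Hm)
      (adelicUnitaryGroup L (Matrix.diagonal ![S.a 0, S.a 1]))
      (adelicUnitaryRat L (Matrix.diagonal ![S.a 0, S.a 1])) :=
  (ThetaKernelDatum.adelicOfDualPair (ΓU := ΓU) (Γ := Γ) ρ hρ hrat SK SK_stable).toPkg.comap
    eV heV eW heW hΓV hΓW

/-- The Weil action of the produced model is `ρ`. -/
@[simp] theorem wmAdelic_W_act (p : GU × G) (Φ : piSchwartzBruhat F ι) :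
    (wmAdelic V S ρ hρ hrat SK SK_stable eV heV hΓV eW heW hΓW).W.act p Φ =
      (ρ p : Module.End ℂ (piSchwartzBruhat F ι)) Φ := rfl

/-- The dual-pair splitting of the produced model is `(eV, eW)` (theta-2's split shape: `Mp := GU × G`, `s := id`). -/
@[simp] theorem wmAdelic_s_apply (x : adelicUnitaryGroup L V.Hm)
    (y : adelicUnitaryGroup L (Matrix.diagonal ![S.a 0, S.a 1])) :
    (wmAdelic V S ρ hρ hrat SK SK_stable eV heV hΓV eW heW hΓW).s (x, y) = (eV x, eW y) := rfl

/-- The index space is the given `SK`. -/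
@[simp] theorem wmAdelic_SK : (wmAdelic V S ρ hρ hrat SK SK_stable eV heV hΓV eW heW hΓW).SK = SK := rfl

/-- **Weil's adelic theta kernel of the pair, upstairs**: `θ_Φ(x, y) = Θ(ρ(eV x⁻¹, eW y⁻¹) Φ)`.
[cite: Weil1964, Chap. III n° 41, p. 193] (provenance only; `rfl`). -/
theorem wmAdelic_thetaFun_mk (Φ : piSchwartzBruhat F ι) (x : adelicUnitaryGroup L V.Hm)
    (y : adelicUnitaryGroup L (Matrix.diagonal ![S.a 0, S.a 1])) :
    (wmAdelic V S ρ hρ hrat SK SK_stable eV heV hΓV eW heW hΓW).thetaFun Φ (x, y) =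
      thetaDistLM F ι ((ρ (eV x⁻¹, eW y⁻¹) : Module.End ℂ (piSchwartzBruhat F ι)) Φ) := rfl

/-- **The END-STATE field `wm V c` (with `S := c.D`), PRODUCED**: the Weil theta model over the model groups of
`V.latticeModel hP` / `S.latticeModelW hP` — `wmAdelic` restricted to the regime subgroups by J1's
`WeilThetaModel.toLatticeModels` (uniform in the regime bit). -/
def wmOf :
    WeilThetaModel (V.latticeModel hP).toQuotientModel.G (V.latticeModel hP).toQuotientModel.Γ
      (S.latticeModelW hP).toQuotientModel.G (S.latticeModelW hP).toQuotientModel.Γ :=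
  WeilThetaModel.toLatticeModels hP V S (wmAdelic V S ρ hρ hrat SK SK_stable eV heV hΓV eW heW hΓW)

/-- (Ported verbatim from the HodgeCMPerL package; no docstring in the source.) -/
theorem wmOf_eq :
    wmOf hP V S ρ hρ hrat SK SK_stable eV heV hΓV eW heW hΓW =
      WeilThetaModel.toRegime (wmAdelic V S ρ hρ hrat SK SK_stable eV heV hΓV eW heW hΓW) := rfl

/-- (Ported verbatim from the HodgeCMPerL package; no docstring in the source.) -/
@[simp] theorem wmOf_W_act (p : GU × G) (Φ : piSchwartzBruhat F ι) :
    (wmOf hP V S ρ hρ hrat SK SK_stable eV heV hΓV eW heW hΓW).W.act p Φ =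
      (ρ p : Module.End ℂ (piSchwartzBruhat F ι)) Φ := rfl

/-- (Ported verbatim from the HodgeCMPerL package; no docstring in the source.) -/
@[simp] theorem wmOf_SK : (wmOf hP V S ρ hρ hrat SK SK_stable eV heV hΓV eW heW hΓW).SK = SK := rfl

/-- Weil's `Θ_Φ(S) = Θ(ρ(S)Φ)` ([Weil1964, Chap. III n° 41 p. 193]; `rfl`). -/
@[simp] theorem wmOf_W_theta (Φ : piSchwartzBruhat F ι) (p : GU × G) :
    (wmOf hP V S ρ hρ hrat SK SK_stable eV heV hΓV eW heW hΓW).W.theta Φ p =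
      thetaDistLM F ι ((ρ p : Module.End ℂ (piSchwartzBruhat F ι)) Φ) := rfl

/-! ### rev-c: the produced model is linear -/

omit [TopologicalSpace GU] [IsTopologicalGroup GU] [LocallyCompactSpace GU] [TopologicalSpace G] [IsTopologicalGroup G]
  [LocallyCompactSpace G] in
/-- (Ported verbatim from the HodgeCMPerL package; no docstring in the source.) -/
theorem rep_act_add (p : GU × G) (Φ Ψ : piSchwartzBruhat F ι) :
    (ρ p : Module.End ℂ (piSchwartzBruhat F ι)) (Φ + Ψ) =
      (ρ p : Module.End ℂ (piSchwartzBruhat F ι)) Φ + (ρ p : Module.End ℂ (piSchwartzBruhat F ι)) Ψ :=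
  map_add _ Φ Ψ

omit [TopologicalSpace GU] [IsTopologicalGroup GU] [LocallyCompactSpace GU] [TopologicalSpace G] [IsTopologicalGroup G]
  [LocallyCompactSpace G] in
/-- (Ported verbatim from the HodgeCMPerL package; no docstring in the source.) -/
theorem rep_act_smul (p : GU × G) (a : ℂ) (Φ : piSchwartzBruhat F ι) :
    (ρ p : Module.End ℂ (piSchwartzBruhat F ι)) (a • Φ) = a • (ρ p : Module.End ℂ (piSchwartzBruhat F ι)) Φ :=
  map_smul _ a Φ

omit [TopologicalSpace GU] [IsTopologicalGroup GU] [LocallyCompactSpace GU] [TopologicalSpace G] [IsTopologicalGroup G]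
  [LocallyCompactSpace G] in
/-- (Ported verbatim from the HodgeCMPerL package; no docstring in the source.) -/
theorem rep_theta_add (Φ Ψ : piSchwartzBruhat F ι) (p : GU × G) :
    thetaDistLM F ι ((ρ p : Module.End ℂ (piSchwartzBruhat F ι)) (Φ + Ψ)) =
      thetaDistLM F ι ((ρ p : Module.End ℂ (piSchwartzBruhat F ι)) Φ) +
        thetaDistLM F ι ((ρ p : Module.End ℂ (piSchwartzBruhat F ι)) Ψ) := by
  rw [map_add, map_add]

omit [TopologicalSpace GU] [IsTopologicalGroup GU] [LocallyCompactSpace GU] [TopologicalSpace G] [IsTopologicalGroup G]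
  [LocallyCompactSpace G] in
/-- (Ported verbatim from the HodgeCMPerL package; no docstring in the source.) -/
theorem rep_theta_smul (a : ℂ) (Φ : piSchwartzBruhat F ι) (p : GU × G) :
    thetaDistLM F ι ((ρ p : Module.End ℂ (piSchwartzBruhat F ι)) (a • Φ)) =
      a * thetaDistLM F ι ((ρ p : Module.End ℂ (piSchwartzBruhat F ι)) Φ) := by
  rw [map_smul, map_smul, smul_eq_mul]

/-- **The produced model is LINEAR** (rev-c; discharges E R7's binder `lin : ∀ V c, (wm V c).LinearStr` in the
kernel): `𝒮(𝔸_F^ι)` is the `ℂ`-submodule `piSchwartzBruhat F ι`, `Φ ↦ ρ(S)Φ` is a `Module.End`, `Φ ↦ Θ(ρ(S)Φ)` is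
the composite of two linear maps, and `𝒮^κ` is closed under `0`, `+`, `•` by hypothesis (in v1: a `Submodule`,
binder-1-g3's `kappaIsotypic`).  Every field is `map_add` / `map_smul` / a hypothesis — nothing cited.  A `def` of class type
(`@[reducible]` as Lean requires); the bundled `instance` is `linearStr_wmOf'`. -/
@[reducible] def linearStr_wmOf (hSK₀ : (0 : piSchwartzBruhat F ι) ∈ SK)
    (hSKadd : ∀ {Φ Ψ : piSchwartzBruhat F ι}, Φ ∈ SK → Ψ ∈ SK → Φ + Ψ ∈ SK)
    (hSKsmul : ∀ (a : ℂ) {Φ : piSchwartzBruhat F ι}, Φ ∈ SK → a • Φ ∈ SK) :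
    (wmOf hP V S ρ hρ hrat SK SK_stable eV heV hΓV eW heW hΓW).LinearStr where
  instACG := inferInstanceAs (AddCommGroup (piSchwartzBruhat F ι))
  instMod := inferInstanceAs (Module ℂ (piSchwartzBruhat F ι))
  act_add := rep_act_add ρ
  act_smul := rep_act_smul ρ
  theta_add := rep_theta_add ρ
  theta_smul := rep_theta_smul ρ
  zero_mem := hSK₀
  add_mem := fun hΦ hΨ => hSKadd hΦ hΨ
  smul_mem := fun a _ hΦ => hSKsmul a hΦ

/-- (Ported verbatim from the HodgeCMPerL package; no docstring in the source.) -/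
@[simp] theorem wmOf_s_apply (x : ↥(regimeSubgroup L V.Hm))
    (y : ↥(regimeSubgroup L (Matrix.diagonal ![S.a 0, S.a 1]))) :
    (wmOf hP V S ρ hρ hrat SK SK_stable eV heV hΓV eW heW hΓW).s (x, y) =
      (eV (x : adelicUnitaryGroup L V.Hm),
        eW (y : adelicUnitaryGroup L (Matrix.diagonal ![S.a 0, S.a 1]))) := rfl

/-- The theta kernel of `wm V c` upstairs, on the regime subgroups: `θ_Φ(x, y) = Θ(ρ(eV x⁻¹, eW y⁻¹) Φ)`. -/
theorem wmOf_thetaFun_mk (Φ : piSchwartzBruhat F ι) (x : ↥(regimeSubgroup L V.Hm))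
    (y : ↥(regimeSubgroup L (Matrix.diagonal ![S.a 0, S.a 1]))) :
    (wmOf hP V S ρ hρ hrat SK SK_stable eV heV hΓV eW heW hΓW).thetaFun Φ (x, y) =
      thetaDistLM F ι ((ρ (eV (x : adelicUnitaryGroup L V.Hm)⁻¹,
        eW (y : adelicUnitaryGroup L (Matrix.diagonal ![S.a 0, S.a 1]))⁻¹) :
          Module.End ℂ (piSchwartzBruhat F ι)) Φ) := rfl

/-- **The dictionary E's consumers use**: the descended theta kernel `θ_Φ ∈ C((GU ⧸ ΓU) × (G ⧸ Γ), ℂ)` of the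
produced model `wm V c`, on cosets of regime elements, IS Weil's adelic theta kernel of the pair:
`θ_Φ(xΓU, yΓ) = Θ(ρ(eV x⁻¹, eW y⁻¹) Φ)`. -/
theorem wmOf_θ_mk (Φ : (wmOf hP V S ρ hρ hrat SK SK_stable eV heV hΓV eW heW hΓW).SK) (x : ↥(regimeSubgroup L V.Hm))
    (y : ↥(regimeSubgroup L (Matrix.diagonal ![S.a 0, S.a 1]))) :
    (wmOf hP V S ρ hρ hrat SK SK_stable eV heV hΓV eW heW hΓW).θ Φ (QuotientGroup.mk x, QuotientGroup.mk y) =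
      thetaDistLM F ι ((ρ (eV (x : adelicUnitaryGroup L V.Hm)⁻¹,
        eW (y : adelicUnitaryGroup L (Matrix.diagonal ![S.a 0, S.a 1]))⁻¹) :
          Module.End ℂ (piSchwartzBruhat F ι)) Φ.1) := by
  rw [WeilThetaModel.θ_mk]
  rfl

end

/-! ### rev-b (E R7, glue-1-g3 00:31:54Z): ONE bundled input record `WmInput V S` and `wmOf' hP W`

So that the E assembler substitutes the `wm` binder by ONE token — `wm := fun V c => wmOf' hP (W V c)` with a single
binder `W : ∀ {L ι₁} (V : HermSpace3 L ι₁) (c : SeesawCtx L), WmInput V c.D` — the seventeen raw inputs of `wmOf`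
(carrier types with their instances, `ρ`, the two K-open / print hypotheses `hρ` / `hrat`, the `K`-type `SK` — a linear
subspace, rev-c —, the
currency conversions) are bundled into one structure.  Nothing is hidden: every field is one of the section variables
above, verbatim; v1 (`HodgeCM/Model/WmInstanceCM.lean`, after K-1) will be `def wmInputCM … : WmInput V S := ⟨…⟩` with
every field a NAMED tree term ((P1) p181553, (J-ρ), (J-CM), (W-1), binder-1 #8), and `wmOf' hP (wmInputCM …)` is then
definitionally the v0 term. -/

/-- **All inputs of the `wm V c` producer, bundled** (one field per section variable of `wmOf`). -/
structure WmInput (V : HermSpace3 L ι₁) (S : StubTree.SeesawDatum L) : Type 1 where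
  /-- the base number field of the Schwartz–Bruhat model (`L⁺` in v1) -/
  F : Type
  [instField : Field F]
  [instNumberField : NumberField F]
  /-- the index type of the symplectic model (`Fin 6` in v1) -/
  ι : Type
  [instFintype : Fintype ι]
  /-- the locally compact group receiving `U(V.Hm)(𝔸)` (`U(diag dV)(𝔸_{L⁺})` in the `UnitaryGroup.adelic` currency in v1) -/
  GU : Type
  [instGroupU : Group GU]
  [instTopU : TopologicalSpace GU]
  [instTopGroupU : IsTopologicalGroup GU]
  [instLCU : LocallyCompactSpace GU]
  /-- its lattice (the rational points) -/
  ΓU : Subgroup GU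
  /-- the locally compact group receiving `U(diag(a₀,a₁))(𝔸)` -/
  G : Type
  [instGroup : Group G]
  [instTop : TopologicalSpace G]
  [instTopGroup : IsTopologicalGroup G]
  [instLC : LocallyCompactSpace G]
  /-- its lattice -/
  Γ : Subgroup G
  /-- the linearised Weil representation of the pair, `ω_ψ ∘ s_pair` -/
  ρ : GU × G →* (Module.End ℂ (piSchwartzBruhat F ι))ˣ
  /-- Weil's theta majorants for `ρ` ((W-1)) -/
  hρ : HasThetaMajorants fun g Φ => (ρ g : Module.End ℂ (piSchwartzBruhat F ι)) Φ
  /-- `Θ`-invariance on rational points (Weil Thm 6 + [GelbartRogawski1991, Prop. 3.1.1]) -/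
  hrat : ∀ γU ∈ ΓU, ∀ γ ∈ Γ, ρ (γU, γ) ∈ thetaStabilizer F ι
  /-- the `K`-type index set and its `G`-stability -/
  SK : Set (piSchwartzBruhat F ι)
  SK_stable : ∀ (h : G) (Φ : piSchwartzBruhat F ι), Φ ∈ SK → (ρ (1, h) : Module.End ℂ (piSchwartzBruhat F ι)) Φ ∈ SK
  /-- `𝒮^κ` is a linear subspace (PerL v5 l. 341; rev-c): it contains `0`, … -/
  SK_zero : (0 : piSchwartzBruhat F ι) ∈ SK
  /-- … is closed under `+` … -/
  SK_add : ∀ {Φ Ψ : piSchwartzBruhat F ι}, Φ ∈ SK → Ψ ∈ SK → Φ + Ψ ∈ SK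
  /-- … and under scalars. -/
  SK_smul : ∀ (a : ℂ) {Φ : piSchwartzBruhat F ι}, Φ ∈ SK → a • Φ ∈ SK
  /-- the currency conversions (continuous, lattice-respecting) -/
  eV : adelicUnitaryGroup L V.Hm →* GU
  heV : Continuous eV
  hΓV : ∀ γ ∈ adelicUnitaryRat L V.Hm, eV γ ∈ ΓU
  eW : adelicUnitaryGroup L (Matrix.diagonal ![S.a 0, S.a 1]) →* G
  heW : Continuous eW
  hΓW : ∀ γ ∈ adelicUnitaryRat L (Matrix.diagonal ![S.a 0, S.a 1]), eW γ ∈ Γ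

attribute [instance] WmInput.instField WmInput.instNumberField WmInput.instFintype WmInput.instGroupU
  WmInput.instTopU WmInput.instTopGroupU WmInput.instLCU WmInput.instGroup WmInput.instTop WmInput.instTopGroup
  WmInput.instLC

/-- **`wm V c` from one bundled input**: `wmOf' hP W := wmOf hP V S W.ρ W.hρ … W.hΓW`.  E R7: `wm := fun V c => wmOf' hP (W V c)`. -/
def wmOf' (hP : PrintFact_unitaryCompact) {V : HermSpace3 L ι₁} {S : StubTree.SeesawDatum L} (W : WmInput V S) :
    WeilThetaModel (V.latticeModel hP).toQuotientModel.G (V.latticeModel hP).toQuotientModel.Γ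
      (S.latticeModelW hP).toQuotientModel.G (S.latticeModelW hP).toQuotientModel.Γ :=
  wmOf hP V S W.ρ W.hρ W.hrat W.SK W.SK_stable W.eV W.heV W.hΓV W.eW W.heW W.hΓW

/-- `wmOf'` is `wmOf` at the fields (definitional). -/
theorem wmOf'_eq (hP : PrintFact_unitaryCompact) {V : HermSpace3 L ι₁} {S : StubTree.SeesawDatum L} (W : WmInput V S) :
    wmOf' hP W = wmOf hP V S W.ρ W.hρ W.hrat W.SK W.SK_stable W.eV W.heV W.hΓV W.eW W.heW W.hΓW := rfl

/-- The Weil action of `wmOf' hP W` is `W.ρ`. -/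
@[simp] theorem wmOf'_W_act (hP : PrintFact_unitaryCompact) {V : HermSpace3 L ι₁} {S : StubTree.SeesawDatum L}
    (W : WmInput V S) (p : W.GU × W.G) (Φ : piSchwartzBruhat W.F W.ι) :
    (wmOf' hP W).W.act p Φ = (W.ρ p : Module.End ℂ (piSchwartzBruhat W.F W.ι)) Φ := rfl

/-- The index set of `wmOf' hP W` is `W.SK`. -/
@[simp] theorem wmOf'_SK (hP : PrintFact_unitaryCompact) {V : HermSpace3 L ι₁} {S : StubTree.SeesawDatum L}
    (W : WmInput V S) : (wmOf' hP W).SK = W.SK := rfl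

/-- **The dictionary for E's consumers, bundled form**: `θ_Φ(xΓU, yΓ) = Θ(ρ(eV x⁻¹, eW y⁻¹) Φ)`. -/
theorem wmOf'_θ_mk (hP : PrintFact_unitaryCompact) {V : HermSpace3 L ι₁} {S : StubTree.SeesawDatum L} (W : WmInput V S)
    (Φ : (wmOf' hP W).SK) (x : ↥(regimeSubgroup L V.Hm)) (y : ↥(regimeSubgroup L (Matrix.diagonal ![S.a 0, S.a 1]))) :
    (wmOf' hP W).θ Φ (QuotientGroup.mk x, QuotientGroup.mk y) =
      thetaDistLM W.F W.ι ((W.ρ (W.eV (x : adelicUnitaryGroup L V.Hm)⁻¹,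
        W.eW (y : adelicUnitaryGroup L (Matrix.diagonal ![S.a 0, S.a 1]))⁻¹) :
          Module.End ℂ (piSchwartzBruhat W.F W.ι)) Φ.1) :=
  wmOf_θ_mk hP V S W.ρ W.hρ W.hrat W.SK W.SK_stable W.eV W.heV W.hΓV W.eW W.heW W.hΓW Φ x y

/-- `Θ_Φ(S) = Θ(W.ρ(S)Φ)` for the bundled producer (`rfl`). -/
@[simp] theorem wmOf'_W_theta (hP : PrintFact_unitaryCompact) {V : HermSpace3 L ι₁} {S : StubTree.SeesawDatum L}
    (W : WmInput V S) (Φ : piSchwartzBruhat W.F W.ι) (p : W.GU × W.G) :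
    (wmOf' hP W).W.theta Φ p = thetaDistLM W.F W.ι ((W.ρ p : Module.End ℂ (piSchwartzBruhat W.F W.ι)) Φ) := rfl

/-- **`wm V c` is a LINEAR Weil theta model** (rev-c) — an `instance`, so E's binder
`lin : ∀ V c, (wmOf' hP (W V c)).LinearStr` is found by `inferInstance` (or supplied as
`fun V c => linearStr_wmOf' hP (W V c)`). -/
instance linearStr_wmOf' (hP : PrintFact_unitaryCompact) {V : HermSpace3 L ι₁} {S : StubTree.SeesawDatum L}
    (W : WmInput V S) : (wmOf' hP W).LinearStr :=
  linearStr_wmOf hP V S W.ρ W.hρ W.hrat W.SK W.SK_stable W.eV W.heV W.hΓV W.eW W.heW W.hΓW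
    W.SK_zero (fun hΦ hΨ => W.SK_add hΦ hΨ) (fun a _ hΦ => W.SK_smul a hΦ)

end HodgeCM.Model

end
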